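import Summits.AnomalousDissipation.AnomalousDissipation.Theorems.TwodBoundedEnergyZeroMomentum.Negative.SteadyShellIdentity
import Literature.Barriers.AnomalousDissipation.GravestModeLaminarAttractorLattice
import Literature.Analysis.FluidPDE.LerayHopfTimeSliceTorus
import Literature.Analysis.FunctionSpaces.TorusLerayHelmholtz

/-!
# A condensate is NECESSARY: steady witnesses under Kolmogorov forcing must carry a sub-shell mode
(negative-side support for the crux `TwoAndHalfD.TwodBoundedEnergyZeroMomentum`, cdisprove seat
`refuter-cdisprove-stmt-AnomalousDissipation-10786-g2-0`, gen 2)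

Companion of `steady_no_subshell_mode_of_no_supershell_mode` (`SteadyShellIdentity`).  Let `g` be a
single-shell force, `ĝ(k) = 0` unless `|k|² = r` (`r ≥ 1`; a Stokes eigenfield, `Δg = -4π²r g`), and
`v` a smooth zero-mean steady state of `NS_ν(g)`, `ν ≠ 0`, WITHOUT sub-shell modes: `v̂(k) = 0` for
`0 < |k|² < r` — e.g. any steady state in a symmetry class whose gravest shell is the forcing shell
(fields `1/m`-periodic in both coordinates under `sin(2πm x₁)e₀`, …).  Then

* `steady_laminar_of_no_subshell_mode` — `v` IS the laminar state: `g = ν(4π²r) v` pointwise, so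
  `(4π²rν)² ∫‖v‖² = ∫‖g‖²` (`steady_energy_eq_of_no_subshell_mode`): the straddle identity
  `∑ λ_k(λ_k - Λ)‖v̂(k)‖² = 0` has only non-negative terms, so `v` lives on the forcing shell; there
  the trilinear form vanishes (`integral_inner_convect_realTrigPoly_eq_zero_of_shellSupported`:
  no equilateral triangles on `ℤ²`), so testing the steady equation with `g - νΛv` kills it.
* `not_boundedSteadyBranch_singleShell_noSubshell` — hence NO bounded steady branch under a
  single-shell force can avoid sub-forcing-scale modes: along `ν_j → 0⁺` its energies would be
  `‖g‖₂²/(4π²rν_j)² → ∞`.  For the crux: under Kolmogorov (single-shell) forcing every bounded steady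
  witness MUST condense below the forcing shell AND (by the companion lemma) excite modes above it;
  in particular it must BREAK every symmetry that excludes the sub-shell modes.

No new definitions.
-/

noncomputable section

open MeasureTheory Set Filter Topology UnitAddTorus
open scoped ENNReal NNReal InnerProductSpace

namespace Summit.AnomalousDissipation.AnomalousDissipation.Theorems.TwodBoundedEnergyZeroMomentum.Negative

open Literature.Analysis.FunctionSpaces Literature.Analysis.FunctionSpaces.Torus
open Literature.Analysis.FluidPDE Literature.Analysis.FluidPDE.Torus
open Literature.Barriers.AnomalousDissipation

/-! ### Single-shell fields: band-limited trigonometric polynomials with `Δw = -4π²r w` -/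

section ShellSupported

variable {w : UnitAddTorus (Fin 2) → EuclideanSpace ℝ (Fin 2)} {r : ℝ} {N : ℕ}

/-- A continuous field with Fourier support on the shell `|k|² = r ≤ N²` is its own truncation
`P_N w`, a real trigonometric polynomial. [folklore] -/
theorem eq_realTrigPoly_of_shellSupported (hwc : Continuous w) (hrN : r ≤ (N : ℝ) ^ 2)
    (hw1 : ∀ k : Fin 2 → ℤ, freqNormSq k ≠ r → mFourierCoeff (EuclideanSpace.complexify ∘ w) k = 0) :
    w = realTrigPoly (freqBall N) (fun k => mFourierCoeff (EuclideanSpace.complexify ∘ w) k) := by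
  have h := fourierTruncate_eq_self hwc (N := N) fun k hk => hw1 k (ne_of_gt (hrN.trans_lt hk))
  conv_lhs => rw [← h]
  rfl

/-- A continuous single-shell field is smooth. [folklore] -/
theorem isSmooth_of_shellSupported (hwc : Continuous w) (hrN : r ≤ (N : ℝ) ^ 2)
    (hw1 : ∀ k : Fin 2 → ℤ, freqNormSq k ≠ r → mFourierCoeff (EuclideanSpace.complexify ∘ w) k = 0) :
    IsSmooth w := by
  rw [eq_realTrigPoly_of_shellSupported hwc hrN hw1]
  exact isSmooth_realTrigPoly _ _

/-- **A single-shell field is a Stokes eigenfield**: `Δw = -4π²r w` pointwise. [folklore] -/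
theorem laplacian_of_shellSupported (hwc : Continuous w) (hrN : r ≤ (N : ℝ) ^ 2)
    (hw1 : ∀ k : Fin 2 → ℤ, freqNormSq k ≠ r → mFourierCoeff (EuclideanSpace.complexify ∘ w) k = 0)
    (x : UnitAddTorus (Fin 2)) : laplacian w x = -(4 * Real.pi ^ 2 * r) • w x := by
  set c : (Fin 2 → ℤ) → EuclideanSpace ℂ (Fin 2) := fun k => mFourierCoeff (EuclideanSpace.complexify ∘ w) k
    with hc
  have hw : w = realTrigPoly (freqBall N) c := eq_realTrigPoly_of_shellSupported hwc hrN hw1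
  have hcoef : ∀ k ∈ freqBall (d := Fin 2) N,
      -(((4 * Real.pi ^ 2 * freqNormSq k : ℝ) : ℂ) • c k) = ((-(4 * Real.pi ^ 2 * r) : ℝ) : ℂ) • c k := by
    intro k _
    by_cases hk : freqNormSq k = r
    · rw [hk, ← neg_smul]
      push_cast
      ring_nf
    · have h0 : c k = 0 := hw1 k hk
      rw [h0, smul_zero, smul_zero, neg_zero]
  rw [hw, laplacian_realTrigPoly, show realTrigPoly (freqBall N)
      (fun k => -(((4 * Real.pi ^ 2 * freqNormSq k : ℝ) : ℂ) • c k)) =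
      realTrigPoly (freqBall N) (fun k => ((-(4 * Real.pi ^ 2 * r) : ℝ) : ℂ) • c k) from
    realTrigPoly_congr hcoef]
  rw [realTrigPoly_apply, realTrigPoly_apply, show (fun k => ((-(4 * Real.pi ^ 2 * r) : ℝ) : ℂ) • c k) =
      ((-(4 * Real.pi ^ 2 * r) : ℝ) : ℂ) • c from rfl, trigPoly_smul, Complex.coe_smul, Pi.smul_apply, map_smul]

/-- A non-zero continuous field has positive energy `∫‖w‖² > 0` (Parseval: some coefficient is
non-zero, else `w = P₀ w = 0`). [folklore] -/
theorem integral_norm_sq_pos_of_ne_zero (hwc : Continuous w) (hw0 : w ≠ 0) : 0 < ∫ x, ‖w x‖ ^ 2 := by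
  by_contra h
  push Not at h
  have hmem : MemLp w 2 volume := hwc.memLp_of_hasCompactSupport (HasCompactSupport.of_compactSpace w)
  have hsum := hasSum_sq_norm_mFourierCoeff_complexify hmem
  have h0 : ∫ x, ‖w x‖ ^ 2 = 0 := le_antisymm h (integral_nonneg fun _ => sq_nonneg _)
  rw [h0] at hsum
  have hall : ∀ k, mFourierCoeff (EuclideanSpace.complexify ∘ w) k = 0 := by
    intro k
    have hk := congrFun ((hasSum_zero_iff_of_nonneg fun k => sq_nonneg _).1 hsum) k
    have hk' : ‖mFourierCoeff (EuclideanSpace.complexify ∘ w) k‖ ^ 2 = 0 := hk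
    exact norm_eq_zero.1 (pow_eq_zero_iff two_ne_zero |>.1 hk')
  apply hw0
  have h1 : fourierTruncate 0 w = w := fourierTruncate_eq_self hwc fun k _ => hall k
  rw [← h1, fourierTruncate_eq]
  have hzero : ∀ k ∈ freqBall (d := Fin 2) 0,
      mFourierCoeff (EuclideanSpace.complexify ∘ w) k = (0 : (Fin 2 → ℤ) → EuclideanSpace ℂ (Fin 2)) k :=
    fun k _ => hall k
  rw [realTrigPoly_congr hzero, realTrigPoly_zero]

end ShellSupported

/-! ### The laminar conclusion -/

section Laminar

variable {ν : ℝ} {g v : UnitAddTorus (Fin 2) → EuclideanSpace ℝ (Fin 2)} {p : UnitAddTorus (Fin 2) → ℝ}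

/-- **Steady states without sub-shell modes are laminar.** Let `g` be single-shell at level
`r ≥ 1` (`ĝ(k) = 0` unless `|k|² = r`), `ν ≠ 0`, and `v` a smooth zero-mean steady state of
`NS_ν(g)` with `v̂(k) = 0` for all `0 < |k|² < r`. Then `g = ν(4π²r)·v` pointwise. Proof: the
straddle identity `∑ λ_k(λ_k - 4π²r)‖v̂(k)‖² = 0` (`steady_hasSum_straddle`) has only non-negative
terms, so `v̂(k) = 0` off the shell too; on one shell the trilinear form vanishes
(`integral_inner_convect_realTrigPoly_eq_zero_of_shellSupported`) and `Δv = -4π²r v`, so testing the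
steady equation `(v·∇)v + ∇p = νΔv + g - … ` against `w = g - 4π²rν v` gives `∫‖w‖² = 0`.
[cite: ConstantinTarfuleaVicol2013, §2 (h2bal)] -/
theorem steady_laminar_of_no_subshell_mode (hν : ν ≠ 0) (hv : IsSteadyNSState ν g v p)
    (hgd : IsDivFree g) {r : ℝ} (hr : 1 ≤ r)
    (hg1 : ∀ k : Fin 2 → ℤ, freqNormSq k ≠ r → mFourierCoeff (EuclideanSpace.complexify ∘ g) k = 0)
    (hvm : HasZeroMean v)
    (hvsub : ∀ k : Fin 2 → ℤ, k ≠ 0 → freqNormSq k < r →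
      mFourierCoeff (EuclideanSpace.complexify ∘ v) k = 0) (x : UnitAddTorus (Fin 2)) :
    g x = (ν * (4 * Real.pi ^ 2 * r)) • v x := by
  classical
  set Λ : ℝ := 4 * Real.pi ^ 2 * r with hΛdef
  set N : ℕ := ⌈r⌉₊ with hN
  have hr0 : (0 : ℝ) < r := one_pos.trans_le hr
  have hrN : r ≤ (N : ℝ) ^ 2 := by
    have h1 : r ≤ (N : ℝ) := Nat.le_ceil r
    have h2 : (1 : ℝ) ≤ N := hr.trans h1
    nlinarith
  have hvs : IsSmooth v := steady_isSmooth hv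
  have hgs : IsSmooth g := steady_isSmooth_force hv
  have hps : IsSmooth p := steady_isSmooth_pressure hv
  have hΛ : ∀ y, laplacian g y = -Λ • g y := laplacian_of_shellSupported hgs.continuous hrN hg1
  -- the straddle identity has non-negative terms only, hence `v` lives on the shell
  have hsum := steady_hasSum_straddle hν hv hΛ
  have hv0 : mFourierCoeff (EuclideanSpace.complexify ∘ v) 0 = 0 :=
    mFourierCoeff_zero_of_hasZeroMean hvs.integrable hvm
  have hnonneg : ∀ k : Fin 2 → ℤ, 0 ≤ 4 * Real.pi ^ 2 * freqNormSq k *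
      (4 * Real.pi ^ 2 * freqNormSq k - Λ) * ‖mFourierCoeff (EuclideanSpace.complexify ∘ v) k‖ ^ 2 := by
    intro k
    by_cases hk0 : k = 0
    · subst hk0
      rw [hv0, norm_zero, zero_pow two_ne_zero, mul_zero]
    by_cases hlt : freqNormSq k < r
    · rw [hvsub k hk0 hlt, norm_zero, zero_pow two_ne_zero, mul_zero]
    · push Not at hlt
      have h1 : 0 ≤ 4 * Real.pi ^ 2 * freqNormSq k := by
        have := freqNormSq_nonneg k
        positivity
      have h2 : 0 ≤ 4 * Real.pi ^ 2 * freqNormSq k - Λ := by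
        simp only [hΛdef]
        nlinarith [Real.pi_pos, sq_nonneg Real.pi]
      have h3 : 0 ≤ ‖mFourierCoeff (EuclideanSpace.complexify ∘ v) k‖ ^ 2 := sq_nonneg _
      positivity
  have hzero := (hasSum_zero_iff_of_nonneg hnonneg).1 hsum
  have hv1 : ∀ k : Fin 2 → ℤ, freqNormSq k ≠ r → mFourierCoeff (EuclideanSpace.complexify ∘ v) k = 0 := by
    intro k hk
    by_cases hk0 : k = 0
    · subst hk0
      exact hv0
    rcases lt_or_gt_of_ne hk with hlt | hgt
    · exact hvsub k hk0 hlt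
    · have hfk := congrFun hzero k
      simp only [Pi.zero_apply] at hfk
      have h1 : 0 < 4 * Real.pi ^ 2 * freqNormSq k := by
        have : 0 < freqNormSq k := hr0.trans hgt
        positivity
      have h2 : 0 < 4 * Real.pi ^ 2 * freqNormSq k - Λ := by
        simp only [hΛdef]
        nlinarith [Real.pi_pos, sq_nonneg Real.pi, mul_pos (mul_pos (by norm_num : (0:ℝ) < 4)
          (pow_pos Real.pi_pos 2)) (sub_pos.2 hgt)]
      have h3 : ‖mFourierCoeff (EuclideanSpace.complexify ∘ v) k‖ ^ 2 = 0 := by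
        rcases mul_eq_zero.1 hfk with h4 | h4
        · rcases mul_eq_zero.1 h4 with h5 | h5
          · exact absurd h5 h1.ne'
          · exact absurd h5 h2.ne'
        · exact h4
      exact norm_eq_zero.1 (pow_eq_zero_iff two_ne_zero |>.1 h3)
  have hvΛ : ∀ y, laplacian v y = -Λ • v y := laplacian_of_shellSupported hvs.continuous hrN hv1
  -- `w = g - νΛ v` satisfies `w = (v·∇)v + ∇p`
  set w : UnitAddTorus (Fin 2) → EuclideanSpace ℝ (Fin 2) := fun y => g y - (ν * Λ) • v y with hwdef
  have hw_eq : ∀ y, w y = convect v v y + gradient p y := by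
    intro y
    have h := steady_convect_eq hv y
    rw [hvΛ y] at h
    simp only [hwdef]
    rw [h, smul_smul, show ν * -Λ = -(ν * Λ) by ring, neg_smul]
    abel
  have hws : IsSmooth w := hgs.sub (hvs.smul (ν * Λ))
  have hwd : IsDivFree w := by
    intro y
    have hsub : w = g - fun z => (ν * Λ) • v z := rfl
    rw [hsub, divergence_sub (u := g) (v := fun z => (ν * Λ) • v z) (hgs.isContDiff (by simp))
      ((hvs.smul (ν * Λ)).isContDiff (by simp)) y, hgd y,
      divergence_fun_const_smul, steady_isDivFree hv y, mul_zero, sub_zero]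
  -- `∫ ⟪w, (v·∇)v⟫ = 0`: all three entries lie in the eigenspace of the shell
  set a : (Fin 2 → ℤ) → EuclideanSpace ℂ (Fin 2) := fun k => mFourierCoeff (EuclideanSpace.complexify ∘ v) k
    with ha
  set cg : (Fin 2 → ℤ) → EuclideanSpace ℂ (Fin 2) := fun k => mFourierCoeff (EuclideanSpace.complexify ∘ g) k
    with hcg
  have hv_poly : v = realTrigPoly (freqBall N) a := eq_realTrigPoly_of_shellSupported hvs.continuous hrN hv1
  have hg_poly : g = realTrigPoly (freqBall N) cg := eq_realTrigPoly_of_shellSupported hgs.continuous hrN hg1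
  set cw : (Fin 2 → ℤ) → EuclideanSpace ℂ (Fin 2) := cg - (((ν * Λ : ℝ) : ℂ) • a) with hcw
  have hw_poly : w = realTrigPoly (freqBall N) cw := by
    funext y
    simp only [hwdef, hcw]
    rw [realTrigPoly_sub, Pi.sub_apply, hg_poly, hv_poly]
    congr 1
    rw [realTrigPoly_apply, realTrigPoly_apply, trigPoly_smul, Complex.coe_smul, Pi.smul_apply, map_smul]
  have htri : ∫ y, ⟪w y, convect v v y⟫_ℝ = 0 := by
    have hS : ∀ k ∈ freqBall (d := Fin 2) N, -k ∈ freqBall N := neg_mem_freqBall_of_mem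
    have haC : IsConjSymm a := isConjSymm_mFourierCoeff hvs.integrable
    have ha1 : IsLatticeShellSupported r a := hv1
    have hcw1 : IsLatticeShellSupported r cw := by
      intro k hk
      have h1 : cg k = 0 := hg1 k hk
      have h2 : a k = 0 := hv1 k hk
      simp only [hcw, Pi.sub_apply, Pi.smul_apply, h1, h2, smul_zero, sub_zero]
    rw [hw_poly, hv_poly]
    exact integral_inner_convect_realTrigPoly_eq_zero_of_shellSupported hr0.ne' hS haC haC ha1 ha1 hcw1
  -- `∫ ⟪∇p, w⟫ = 0`
  have hgrad : ∫ y, ⟪gradient p y, w y⟫_ℝ = 0 := integral_inner_gradient_eq_zero_of_isDivFree hws hps hwd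
  -- hence `∫ ‖w‖² = 0`, `w = 0`
  have hint : ∫ y, ‖w y‖ ^ 2 = 0 := by
    have i1 : Integrable (fun y => ⟪w y, convect v v y⟫_ℝ) volume := (hws.inner (hvs.convect hvs)).integrable
    have i2 : Integrable (fun y => ⟪gradient p y, w y⟫_ℝ) volume := (hps.gradient.inner hws).integrable
    calc ∫ y, ‖w y‖ ^ 2 = ∫ y, ⟪w y, w y⟫_ℝ := integral_congr_ae (ae_of_all _ fun y => (real_inner_self_eq_norm_sq _).symm)
      _ = ∫ y, (⟪w y, convect v v y⟫_ℝ + ⟪gradient p y, w y⟫_ℝ) := by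
          refine integral_congr_ae (ae_of_all _ fun y => ?_)
          show ⟪w y, w y⟫_ℝ = ⟪w y, convect v v y⟫_ℝ + ⟪gradient p y, w y⟫_ℝ
          have h1 : ⟪w y, w y⟫_ℝ = ⟪w y, convect v v y + gradient p y⟫_ℝ := by rw [← hw_eq y]
          rw [h1, inner_add_right, real_inner_comm (w y) (gradient p y)]
      _ = 0 := by rw [integral_add i1 i2, htri, hgrad, add_zero]
  have hw0 : w = 0 := by
    by_contra hne
    exact absurd hint (integral_norm_sq_pos_of_ne_zero hws.continuous hne).ne'
  have := congrFun hw0 x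
  simp only [hwdef, Pi.zero_apply, sub_eq_zero] at this
  simpa only [hΛdef] using this

/-- **Energy of a steady state without sub-shell modes**: `(4π²rν)² ∫‖v‖² = ∫‖g‖²` — the laminar
energy `‖g‖₂²/(νλ)²`, unbounded as `ν → 0` at fixed `g ≠ 0`. [cite: ConstantinTarfuleaVicol2013, §2] -/
theorem steady_energy_eq_of_no_subshell_mode (hν : ν ≠ 0) (hv : IsSteadyNSState ν g v p)
    (hgd : IsDivFree g) {r : ℝ} (hr : 1 ≤ r)
    (hg1 : ∀ k : Fin 2 → ℤ, freqNormSq k ≠ r → mFourierCoeff (EuclideanSpace.complexify ∘ g) k = 0)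
    (hvm : HasZeroMean v)
    (hvsub : ∀ k : Fin 2 → ℤ, k ≠ 0 → freqNormSq k < r →
      mFourierCoeff (EuclideanSpace.complexify ∘ v) k = 0) :
    (ν * (4 * Real.pi ^ 2 * r)) ^ 2 * ∫ x, ‖v x‖ ^ 2 = ∫ x, ‖g x‖ ^ 2 := by
  rw [← integral_const_mul]
  refine integral_congr_ae (ae_of_all _ fun x => ?_)
  show (ν * (4 * Real.pi ^ 2 * r)) ^ 2 * ‖v x‖ ^ 2 = ‖g x‖ ^ 2
  rw [steady_laminar_of_no_subshell_mode hν hv hgd hr hg1 hvm hvsub x, norm_smul, Real.norm_eq_abs,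
    mul_pow (|ν * (4 * Real.pi ^ 2 * r)|), sq_abs]

end Laminar

/-! ### No bounded steady branch without a condensate -/

/-- **Every bounded steady branch under single-shell forcing condenses below the forcing shell.**
There is NO divergence-free single-shell force `g ≠ 0` (Fourier support on `|k|² = r`, `r ≥ 1`) with zero-mean smooth steady states `v_j` of `NS_{ν_j}(g)`, `ν_j → 0⁺`,
of bounded energy, all WITHOUT sub-shell modes (`v̂_j(k) = 0` for `0 < |k|² < r`): such states are
laminar with energy `‖g‖₂²/(4π²rν_j)² → ∞`. Under Kolmogorov forcing a bounded steady witness of the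
crux therefore MUST excite modes strictly below the forcing shell (a condensate) — and then, by
`steady_no_subshell_mode_of_no_supershell_mode`, modes strictly above it as well. [folklore] -/
theorem not_boundedSteadyBranch_singleShell_noSubshell :
    ¬ ∃ (g : UnitAddTorus (Fin 2) → EuclideanSpace ℝ (Fin 2)) (r : ℝ), 1 ≤ r ∧ IsDivFree g ∧ g ≠ 0 ∧
      (∀ k : Fin 2 → ℤ, freqNormSq k ≠ r → mFourierCoeff (EuclideanSpace.complexify ∘ g) k = 0) ∧
      ∃ (ν : ℕ → ℝ) (v : ℕ → UnitAddTorus (Fin 2) → EuclideanSpace ℝ (Fin 2))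
        (p : ℕ → UnitAddTorus (Fin 2) → ℝ),
        (∀ j, 0 < ν j) ∧ Tendsto ν atTop (𝓝 0) ∧
        (∀ j, IsSteadyNSState (ν j) g (v j) (p j)) ∧ (∀ j, HasZeroMean (v j)) ∧
        (∀ j (k : Fin 2 → ℤ), k ≠ 0 → freqNormSq k < r →
          mFourierCoeff (EuclideanSpace.complexify ∘ v j) k = 0) ∧
        ∃ E : ℝ, ∀ j, ∫ x, ‖v j x‖ ^ 2 ≤ E := by
  rintro ⟨g, r, hr, hgd, hg0, hg1, ν, v, p, hν, hν0, hst, hvm, hvsub, E, hE⟩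
  set A : ℝ := ∫ x, ‖g x‖ ^ 2 with hA
  set Λ : ℝ := 4 * Real.pi ^ 2 * r with hΛ
  have hgc : Continuous g := (steady_isSmooth_force (hst 0)).continuous
  have hA0 : 0 < A := integral_norm_sq_pos_of_ne_zero hgc hg0
  have hΛ0 : 0 < Λ := by
    have : (0 : ℝ) < r := one_pos.trans_le hr
    positivity
  have hEj : ∀ j, (ν j * Λ) ^ 2 * ∫ x, ‖v j x‖ ^ 2 = A := fun j =>
    steady_energy_eq_of_no_subshell_mode (hν j).ne' (hst j) hgd hr hg1 (hvm j) (hvsub j)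
  have hE0 : 0 < E := by
    have h1 := hEj 0
    have h2 := hE 0
    have h3 : 0 < (ν 0 * Λ) ^ 2 := by
      have := hν 0
      positivity
    by_contra hle
    push Not at hle
    have : (ν 0 * Λ) ^ 2 * ∫ x, ‖v 0 x‖ ^ 2 ≤ 0 :=
      mul_nonpos_of_nonneg_of_nonpos h3.le (h2.trans hle) |> fun h => by nlinarith [h2, hle, h3]
    linarith
  -- `ν_j² ≥ A/(Λ² E)`
  have hlow : ∀ j, A / (Λ ^ 2 * E) ≤ ν j ^ 2 := fun j => by
    have h1 := hEj j
    have h2 := hE j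
    have h3 : 0 < (ν j * Λ) ^ 2 := by
      have := hν j
      positivity
    rw [div_le_iff₀ (by positivity)]
    calc A = (ν j * Λ) ^ 2 * ∫ x, ‖v j x‖ ^ 2 := h1.symm
      _ ≤ (ν j * Λ) ^ 2 * E := mul_le_mul_of_nonneg_left h2 h3.le
      _ = ν j ^ 2 * (Λ ^ 2 * E) := by ring
  have hsq : Tendsto (fun j => ν j ^ 2) atTop (𝓝 0) := by simpa using hν0.pow 2
  have hc : 0 < A / (Λ ^ 2 * E) := by positivity
  obtain ⟨j, hj⟩ := ((tendsto_order.1 hsq).2 _ hc).exists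
  exact absurd (hlow j) (not_le.2 hj)

end Summit.AnomalousDissipation.AnomalousDissipation.Theorems.TwodBoundedEnergyZeroMomentum.Negative

end
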